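import Summits.Ventures.HSemireg.Pad4TowerUniverseU5

/-!
# Venture HSemireg — PAD-4: the universe U6 = {O, ℓ, 2ℓ, 3ℓ, 2I+ℓ, 2I+2ℓ} — the ×2'd REDUCTION in kernel form, (F1ℝ) slice
# (support ⊆ M*(U6); the three tower species are A2I-dead; species-free supports ⊆ M**(U6); the alive part is class y on both levels)

HONEST FRAMING. Lean index of the computation cell `pub-hsemireg` (S4-PUSH, H2 door PAD-4); seat `hodge-semireg-assembly-p1`
(director-hodge g7 WIDTH-LEVER W2 on stmt-HodgeConjecture-18881: «the universe-closure census entries U(D_T1), U5, U6 as Lean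
theorems from the tower files»). **U6 HAS NO CLOSURE ENTRY: U6 IS NOT CLOSED** (s4-ref g72 ba57d2acffb5afa2: «U6 IS NOT CLOSED by
this: the CENSUS QUESTION (decorated class-y cores) stays OPEN»). What IS of record and ×2 is the REDUCTION of bc5-plan g3 (cell INBOX
l.30322, kit j274473 + own fixpoints; ×2 s4-ref g72 (A)–(E)): (i′-before) the greatest RULE-D-closed orbit-union M*(U6) = 74 orbits;
(i) the three tower species N [O|ℓ|ℓ|T], [O|ℓ|2ℓ|T], [O|2ℓ|2ℓ|T] are DEAD by LEMMA A∪2I′ clean form (own-orbit servers, census empty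
against all P-classes of M*(U6)); (i′) deleting them and re-running the fixpoint leaves M**(U6) = 68 orbits (cascade: P [O|O|ℓ|T],
[O|O|2ℓ|T], then N [O|O|T|T]); (Ψ) on M** the only Ψ ≠ 0 shapes are the class-y fully charged N's `[ℓ^a 2ℓ^b]` (Ψ = Πc) and P `[ℓℓℓℓ]`
(Ψ = 1) ⇒ «every (H1)-alive RULE-D-closed two-level support over the alphabet is a CLASS-y DESIGN ON BOTH LEVELS (P-side FC =
[ℓℓℓℓ] only) decorated with Ψ-null, non-FC material» (×1 HENCE of l.30322; its inputs ×2). This file proves exactly that chain on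
the (F1ℝ) SLICE (phases `±1`; cells of `Pad4TowerLemmaT` with normalised letters in the alphabet, either side, any placement), with
the typed RULE D and kill predicate, the species step as a HYPOTHESIS where the pencil uses (E1).

THE CERTIFICATES. This seat's mirror (`sim/ruleD.py`, `sim/cert.py`, `sim/stage2.py`, cell staging) recomputed both fixpoints on the
(F1ℝ) slice with the typed rule: M*(U6)^ℝ = 37 `N` + 19 `P` shapes and M**(U6)^ℝ = 33 + 17 shapes — bc5-plan's 74 and 68 orbits
exactly, once the fully charged shapes' four phase classes are counted (52 + 22, 48 + 20); the stage-2 cascade is g72's (D) verbatim.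
Shape letters below are `Pad4TowerPsi`'s `lO, l1, l2, l3, t2Il, t2I2l` = `O, ℓ, 2ℓ, 3ℓ, 2I+ℓ, 2I+2ℓ` in light-cone form.

CONTENT. §1 alphabet (`u6Letters`, `InU6`, the 126 shapes `u6Keys`; completeness via `key_mem_keysOver`). §2 stage 1: `u6Rounds` (6 rounds, 196
certificates), `u6MstarN`∕`u6MstarP`, `u6Rounds_ok` (decide), `u6_support_subset_Mstar` (via `Pad4TowerRuleDFixpoint.rounds_sound`).
§3 `u6Mstar_species_facts` (the species are M* shapes; every tower-carrying `P`-shape of M* has two O's) and `u6_species_A2IDead`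
(= `Pad4TowerUniverseDT1.species_A2IDead` with PK = M*(U6)'s `P`-shapes; `S₄`-invariant — a fortiori G-invariant — `N`-support). §4 stage 2: `u6Rounds2`,
`u6MssN`∕`u6MssP`, `u6Rounds2_ok`, `u6_speciesFree_subset_Mss`. §5 `u6Mss_table` (decide: O ⇒ Ψ = 0; no O ⇒ Ψ > 0 and all letters
pure rays; towers sit next to ≥ 2 O's) and `u6_alive_part_classY`: species-free RULE-D-closed design + Ψ-row + μ ≠ 0 ⇒ every no-O
constituent is a class-y ray cell, and no-O constituents occur on BOTH levels (P-side: `[ℓℓℓℓ]`).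

WHAT IS NOT HERE ∕ NOT IN LEAN. A closure of U6 (none exists on the record); the (E1)-meaning of `A2IDead` and of RULE D; Ψ's
annihilation of `ℚ[h] ⊕ W`; THEOREM L^ζ on the decorated class-y cores (`Pad4FirstOrderModel.TheoremLZeta`, kernel-OPEN); the μ₄
phases `±i`; gs-eng-2's (H1)-LP on M** (l.30375). Nothing is a statement about a variety, a sheaf, σ, a seed or an abelian variety;
NOTHING HERE SAYS THAT HC ∕ HC_CM ∕ HC_AV ∕ W₆ ∕ HC_Kum4Type HOLDS OR FAILS. No `instance`, no notation, no named fact, 0 `sorry`;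
axioms standard.

SOURCES (sha16): bc5-plan g3 cell INBOX l.30322 (U6 decision tree (i)(i′), `ref_three_orbits_U6.out.txt` 2deb3159ac0a7380,
`MstarU6_universe.json` d5cac46c86bcd8be, `Mstarstar_U6_orbits.json`), l.30327; s4-ref g72 verdict ba57d2acffb5afa2 (l.30400);
BC5-PLAN-g3-MEMO v3.2 §13 (G)(G′)(H); `Pad4TowerLemmaT.lean` bfb2cc0a1a90b649, `Pad4TowerLemmaA2I.lean` f584dd8287830a21,
`Pad4TowerPsi.lean` b23c6bbb35c2be0c; `Pad4TowerUniverseDT1` ∕ `RuleDFixpoint` ∕ `UniverseU5` (this seat).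
-/

namespace Summit.Ventures.HSemireg.Pad4Tower

open Finset

/-! ## §1 The alphabet and its 126 shapes -/

/-- the letters of U6 in light-cone form: `O`, `ℓ`, `2ℓ`, `T = 2I+ℓ`, `3ℓ`, `T2 = 2I+2ℓ` (listed in the order of their light-cone pairs). -/
def u6Letters : List (ℕ × ℕ) := [lO, l1, l2, t2Il, l3, t2I2l]

/-- a cell lies in the universe U6^ℝ: each of its four normalised letters is one of the six. -/
abbrev InU6 (Z : Cell) : Prop := ∀ f, nl Z f ∈ u6Letters

/-- the 126 shapes over the alphabet. -/
def u6Keys : List (Multiset (ℕ × ℕ)) := keysOver u6Letters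

/-- 126 shapes; letters with coordinates `≤ 3`. [kernel, `decide`] -/
theorem u6Keys_spec : u6Keys.length = 126 ∧ ∀ x ∈ u6Letters, x.1 ≤ 3 := by decide +kernel

/-- a cell of the universe has its shape among the 126 (`Pad4TowerRuleDFixpoint.key_mem_keysOver`). -/
theorem key_mem_u6Keys {Z : Cell} (h : InU6 Z) : Z.key ∈ u6Keys := key_mem_keysOver h

/-! ## §2 Stage (i′)-before: every RULE-D-closed support in U6^ℝ lies in M*(U6) (6 rounds; = bc5-plan's 74 orbits) -/

/-- the deletion rounds of U6^ℝ (this seat's `sim/ruleD.py` ∕ `sim/cert.py` on the typed RULE D), one certificate per leaving shape. -/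
def u6Rounds : List Round :=
  [ -- round 1: 0 N-shapes and 61 P-shapes leave
    ([],
     [⟨{lO, lO, t2Il, l3}, t2Il, false, l3, true⟩, ⟨{lO, lO, t2Il, t2I2l}, t2I2l, true, t2Il, false⟩,
      ⟨{lO, lO, l3, t2I2l}, t2I2l, false, l3, true⟩, ⟨{lO, lO, t2I2l, t2I2l}, t2I2l, true, t2I2l, false⟩,
      ⟨{lO, l1, t2Il, l3}, t2Il, false, l3, true⟩, ⟨{lO, l1, t2Il, t2I2l}, t2I2l, true, t2Il, false⟩,
      ⟨{lO, l1, l3, t2I2l}, t2I2l, false, l3, true⟩, ⟨{lO, l1, t2I2l, t2I2l}, t2I2l, true, t2I2l, false⟩,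
      ⟨{lO, l2, t2Il, l3}, t2Il, false, l3, true⟩, ⟨{lO, l2, t2Il, t2I2l}, t2I2l, true, t2Il, false⟩,
      ⟨{lO, l2, l3, t2I2l}, t2I2l, false, l3, true⟩, ⟨{lO, l2, t2I2l, t2I2l}, t2I2l, true, t2I2l, false⟩,
      ⟨{lO, t2Il, t2Il, l3}, t2Il, false, l3, true⟩, ⟨{lO, t2Il, t2Il, t2I2l}, t2I2l, true, t2Il, false⟩,
      ⟨{lO, t2Il, l3, l3}, t2Il, false, l3, true⟩, ⟨{lO, t2Il, l3, t2I2l}, t2I2l, true, t2Il, false⟩,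
      ⟨{lO, t2Il, t2I2l, t2I2l}, t2I2l, true, t2I2l, false⟩, ⟨{lO, l3, l3, t2I2l}, t2I2l, false, l3, true⟩,
      ⟨{lO, l3, t2I2l, t2I2l}, t2I2l, true, t2I2l, false⟩, ⟨{lO, t2I2l, t2I2l, t2I2l}, t2I2l, true, t2I2l, false⟩,
      ⟨{l1, l1, t2Il, l3}, t2Il, false, l3, true⟩, ⟨{l1, l1, t2Il, t2I2l}, t2I2l, true, t2Il, false⟩,
      ⟨{l1, l1, l3, t2I2l}, t2I2l, false, l3, true⟩, ⟨{l1, l1, t2I2l, t2I2l}, t2I2l, true, t2I2l, false⟩,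
      ⟨{l1, l2, t2Il, l3}, t2Il, false, l3, true⟩, ⟨{l1, l2, t2Il, t2I2l}, t2I2l, true, t2Il, false⟩,
      ⟨{l1, l2, l3, t2I2l}, t2I2l, false, l3, true⟩, ⟨{l1, l2, t2I2l, t2I2l}, t2I2l, true, t2I2l, false⟩,
      ⟨{l1, t2Il, t2Il, l3}, t2Il, false, l3, true⟩, ⟨{l1, t2Il, t2Il, t2I2l}, t2I2l, true, t2Il, false⟩,
      ⟨{l1, t2Il, l3, l3}, t2Il, false, l3, true⟩, ⟨{l1, t2Il, l3, t2I2l}, t2I2l, true, t2Il, false⟩,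
      ⟨{l1, t2Il, t2I2l, t2I2l}, t2I2l, true, t2I2l, false⟩, ⟨{l1, l3, l3, t2I2l}, t2I2l, false, l3, true⟩,
      ⟨{l1, l3, t2I2l, t2I2l}, t2I2l, true, t2I2l, false⟩, ⟨{l1, t2I2l, t2I2l, t2I2l}, t2I2l, true, t2I2l, false⟩,
      ⟨{l2, l2, t2Il, l3}, t2Il, false, l3, true⟩, ⟨{l2, l2, t2Il, t2I2l}, t2I2l, true, t2Il, false⟩,
      ⟨{l2, l2, l3, t2I2l}, t2I2l, false, l3, true⟩, ⟨{l2, l2, t2I2l, t2I2l}, t2I2l, true, t2I2l, false⟩,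
      ⟨{l2, t2Il, t2Il, l3}, t2Il, false, l3, true⟩, ⟨{l2, t2Il, t2Il, t2I2l}, t2I2l, true, t2Il, false⟩,
      ⟨{l2, t2Il, l3, l3}, t2Il, false, l3, true⟩, ⟨{l2, t2Il, l3, t2I2l}, t2I2l, true, t2Il, false⟩,
      ⟨{l2, t2Il, t2I2l, t2I2l}, t2I2l, true, t2I2l, false⟩, ⟨{l2, l3, l3, t2I2l}, t2I2l, false, l3, true⟩,
      ⟨{l2, l3, t2I2l, t2I2l}, t2I2l, true, t2I2l, false⟩, ⟨{l2, t2I2l, t2I2l, t2I2l}, t2I2l, true, t2I2l, false⟩,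
      ⟨{t2Il, t2Il, t2Il, l3}, t2Il, false, l3, true⟩, ⟨{t2Il, t2Il, t2Il, t2I2l}, t2I2l, true, t2Il, false⟩,
      ⟨{t2Il, t2Il, l3, l3}, t2Il, false, l3, true⟩, ⟨{t2Il, t2Il, l3, t2I2l}, t2I2l, true, t2Il, false⟩,
      ⟨{t2Il, t2Il, t2I2l, t2I2l}, t2I2l, true, t2I2l, false⟩, ⟨{t2Il, l3, l3, l3}, t2Il, false, l3, true⟩,
      ⟨{t2Il, l3, l3, t2I2l}, t2I2l, true, t2Il, false⟩, ⟨{t2Il, l3, t2I2l, t2I2l}, t2I2l, true, t2I2l, false⟩,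
      ⟨{t2Il, t2I2l, t2I2l, t2I2l}, t2I2l, true, t2I2l, false⟩, ⟨{l3, l3, l3, t2I2l}, t2I2l, false, l3, true⟩,
      ⟨{l3, l3, t2I2l, t2I2l}, t2I2l, true, t2I2l, false⟩, ⟨{l3, t2I2l, t2I2l, t2I2l}, t2I2l, true, t2I2l, false⟩,
      ⟨{t2I2l, t2I2l, t2I2l, t2I2l}, t2I2l, true, t2I2l, false⟩]),
    -- round 2: 59 N-shapes and 0 P-shapes leave
    ([⟨{lO, lO, t2Il, t2I2l}, t2I2l, false, lO, true⟩, ⟨{lO, lO, t2I2l, t2I2l}, t2I2l, false, lO, true⟩,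
      ⟨{lO, l1, t2Il, l3}, l1, true, l3, false⟩, ⟨{lO, l1, t2Il, t2I2l}, l1, false, t2I2l, false⟩,
      ⟨{lO, l1, l3, t2I2l}, l1, true, l3, false⟩, ⟨{lO, l1, t2I2l, t2I2l}, l1, false, t2I2l, false⟩,
      ⟨{lO, l2, t2Il, l3}, l2, true, l3, false⟩, ⟨{lO, l2, t2Il, t2I2l}, t2I2l, false, l2, false⟩,
      ⟨{lO, l2, l3, t2I2l}, l2, true, l3, false⟩, ⟨{lO, l2, t2I2l, t2I2l}, t2I2l, false, l2, false⟩,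
      ⟨{lO, t2Il, t2Il, l3}, t2Il, false, l3, false⟩, ⟨{lO, t2Il, t2Il, t2I2l}, t2I2l, false, lO, true⟩,
      ⟨{lO, t2Il, l3, l3}, l3, true, l3, false⟩, ⟨{lO, t2Il, l3, t2I2l}, t2I2l, false, l3, false⟩,
      ⟨{lO, t2Il, t2I2l, t2I2l}, t2I2l, false, lO, true⟩, ⟨{lO, l3, l3, t2I2l}, l3, true, l3, false⟩,
      ⟨{lO, l3, t2I2l, t2I2l}, t2I2l, false, l3, false⟩, ⟨{lO, t2I2l, t2I2l, t2I2l}, t2I2l, false, lO, true⟩,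
      ⟨{l1, l1, t2Il, l3}, l1, true, l1, false⟩, ⟨{l1, l1, t2Il, t2I2l}, l1, true, l1, false⟩,
      ⟨{l1, l1, l3, t2I2l}, l1, true, l1, false⟩, ⟨{l1, l1, t2I2l, t2I2l}, l1, true, l1, false⟩,
      ⟨{l1, l2, t2Il, l3}, l1, true, l2, false⟩, ⟨{l1, l2, t2Il, t2I2l}, l1, false, t2I2l, false⟩,
      ⟨{l1, l2, l3, t2I2l}, l1, true, l2, false⟩, ⟨{l1, l2, t2I2l, t2I2l}, l1, false, t2I2l, false⟩,
      ⟨{l1, t2Il, t2Il, l3}, l1, false, t2Il, false⟩, ⟨{l1, t2Il, t2Il, t2I2l}, l1, false, t2I2l, false⟩,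
      ⟨{l1, t2Il, l3, l3}, l1, true, l3, false⟩, ⟨{l1, t2Il, l3, t2I2l}, l1, false, t2I2l, false⟩,
      ⟨{l1, t2Il, t2I2l, t2I2l}, l1, false, t2I2l, false⟩, ⟨{l1, l3, l3, t2I2l}, l1, true, l3, false⟩,
      ⟨{l1, l3, t2I2l, t2I2l}, l1, false, t2I2l, false⟩, ⟨{l1, t2I2l, t2I2l, t2I2l}, l1, false, t2I2l, false⟩,
      ⟨{l2, l2, t2Il, l3}, l2, true, l2, false⟩, ⟨{l2, l2, t2Il, t2I2l}, t2I2l, false, l2, false⟩,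
      ⟨{l2, l2, l3, t2I2l}, l2, true, l2, false⟩, ⟨{l2, l2, t2I2l, t2I2l}, t2I2l, false, l2, false⟩,
      ⟨{l2, t2Il, t2Il, l3}, l2, false, t2Il, false⟩, ⟨{l2, t2Il, t2Il, t2I2l}, t2I2l, false, l2, false⟩,
      ⟨{l2, t2Il, l3, l3}, l2, true, l3, false⟩, ⟨{l2, t2Il, l3, t2I2l}, t2I2l, false, l2, false⟩,
      ⟨{l2, t2Il, t2I2l, t2I2l}, t2I2l, false, l2, false⟩, ⟨{l2, l3, l3, t2I2l}, l2, true, l3, false⟩,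
      ⟨{l2, l3, t2I2l, t2I2l}, t2I2l, false, l2, false⟩, ⟨{l2, t2I2l, t2I2l, t2I2l}, t2I2l, false, l2, false⟩,
      ⟨{t2Il, t2Il, t2Il, l3}, t2Il, false, l3, false⟩, ⟨{t2Il, t2Il, t2Il, t2I2l}, t2I2l, false, t2Il, true⟩,
      ⟨{t2Il, t2Il, l3, l3}, t2Il, false, l3, false⟩, ⟨{t2Il, t2Il, l3, t2I2l}, t2I2l, false, l3, false⟩,
      ⟨{t2Il, t2Il, t2I2l, t2I2l}, t2I2l, false, t2Il, true⟩, ⟨{t2Il, l3, l3, l3}, l3, true, l3, false⟩,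
      ⟨{t2Il, l3, l3, t2I2l}, t2I2l, false, l3, false⟩, ⟨{t2Il, l3, t2I2l, t2I2l}, t2I2l, false, l3, false⟩,
      ⟨{t2Il, t2I2l, t2I2l, t2I2l}, t2I2l, false, t2Il, true⟩, ⟨{l3, l3, l3, t2I2l}, l3, true, l3, false⟩,
      ⟨{l3, l3, t2I2l, t2I2l}, t2I2l, false, l3, false⟩, ⟨{l3, t2I2l, t2I2l, t2I2l}, t2I2l, false, l3, false⟩,
      ⟨{t2I2l, t2I2l, t2I2l, t2I2l}, t2I2l, true, t2I2l, false⟩],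
     []),
    -- round 3: 0 N-shapes and 40 P-shapes leave
    ([],
     [⟨{lO, lO, l1, t2I2l}, l1, false, t2I2l, true⟩, ⟨{lO, lO, l2, t2I2l}, t2I2l, true, l2, false⟩,
      ⟨{lO, lO, t2Il, t2Il}, t2Il, true, t2Il, false⟩, ⟨{lO, l1, l1, l3}, l1, false, l3, true⟩,
      ⟨{lO, l1, l1, t2I2l}, l1, false, t2I2l, true⟩, ⟨{lO, l1, l2, t2Il}, l2, true, t2Il, false⟩,
      ⟨{lO, l1, l2, l3}, l1, false, l3, true⟩, ⟨{lO, l1, l2, t2I2l}, l2, true, t2I2l, true⟩,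
      ⟨{lO, l1, t2Il, t2Il}, t2Il, true, t2Il, false⟩, ⟨{lO, l1, l3, l3}, l1, false, l3, true⟩,
      ⟨{lO, l2, l2, t2Il}, l2, true, t2Il, false⟩, ⟨{lO, l2, l2, l3}, l2, false, l3, true⟩,
      ⟨{lO, l2, l2, t2I2l}, t2I2l, true, l2, true⟩, ⟨{lO, l2, t2Il, t2Il}, l2, true, t2Il, false⟩,
      ⟨{lO, l2, l3, l3}, l2, false, l3, true⟩, ⟨{lO, t2Il, t2Il, t2Il}, t2Il, true, t2Il, false⟩,
      ⟨{lO, l3, l3, l3}, l3, true, l3, false⟩, ⟨{l1, l1, l1, l3}, l1, false, l3, true⟩,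
      ⟨{l1, l1, l1, t2I2l}, l1, false, t2I2l, true⟩, ⟨{l1, l1, l2, t2Il}, l2, true, t2Il, false⟩,
      ⟨{l1, l1, l2, l3}, l1, false, l3, true⟩, ⟨{l1, l1, l2, t2I2l}, l2, true, t2I2l, true⟩,
      ⟨{l1, l1, t2Il, t2Il}, t2Il, true, t2Il, false⟩, ⟨{l1, l1, l3, l3}, l1, false, l3, true⟩,
      ⟨{l1, l2, l2, t2Il}, l2, true, t2Il, false⟩, ⟨{l1, l2, l2, l3}, l1, false, l3, true⟩,
      ⟨{l1, l2, l2, t2I2l}, l2, true, t2I2l, true⟩, ⟨{l1, l2, t2Il, t2Il}, l2, true, t2Il, false⟩,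
      ⟨{l1, l2, l3, l3}, l1, false, l3, true⟩, ⟨{l1, t2Il, t2Il, t2Il}, t2Il, true, t2Il, false⟩,
      ⟨{l1, l3, l3, l3}, l1, false, l3, true⟩, ⟨{l2, l2, l2, t2Il}, l2, true, t2Il, false⟩,
      ⟨{l2, l2, l2, l3}, l2, false, l3, true⟩, ⟨{l2, l2, l2, t2I2l}, t2I2l, true, l2, true⟩,
      ⟨{l2, l2, t2Il, t2Il}, l2, true, t2Il, false⟩, ⟨{l2, l2, l3, l3}, l2, false, l3, true⟩,
      ⟨{l2, t2Il, t2Il, t2Il}, l2, true, t2Il, false⟩, ⟨{l2, l3, l3, l3}, l2, false, l3, true⟩,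
      ⟨{t2Il, t2Il, t2Il, t2Il}, t2Il, true, t2Il, false⟩, ⟨{l3, l3, l3, l3}, l3, true, l3, false⟩]),
    -- round 4: 29 N-shapes and 0 P-shapes leave
    ([⟨{lO, l1, l1, t2I2l}, l1, true, l1, false⟩, ⟨{lO, l1, l2, t2I2l}, l1, false, t2I2l, false⟩,
      ⟨{lO, l1, t2Il, t2Il}, l1, false, t2Il, false⟩, ⟨{lO, l2, l2, t2I2l}, t2I2l, false, l2, false⟩,
      ⟨{lO, l2, t2Il, t2Il}, l2, false, t2Il, false⟩, ⟨{lO, t2Il, t2Il, t2Il}, t2Il, false, lO, true⟩,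
      ⟨{l1, l1, l1, l3}, l1, true, l1, false⟩, ⟨{l1, l1, l1, t2I2l}, l1, true, l1, false⟩,
      ⟨{l1, l1, l2, t2Il}, l1, true, l1, false⟩, ⟨{l1, l1, l2, l3}, l1, true, l1, false⟩,
      ⟨{l1, l1, l2, t2I2l}, l1, true, l1, false⟩, ⟨{l1, l1, t2Il, t2Il}, l1, true, l1, false⟩,
      ⟨{l1, l1, l3, l3}, l1, true, l1, false⟩, ⟨{l1, l2, l2, t2Il}, l1, true, l2, false⟩,
      ⟨{l1, l2, l2, l3}, l1, true, l2, false⟩, ⟨{l1, l2, l2, t2I2l}, l1, false, t2I2l, false⟩,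
      ⟨{l1, l2, t2Il, t2Il}, l1, true, l2, false⟩, ⟨{l1, l2, l3, l3}, l1, true, l2, false⟩,
      ⟨{l1, t2Il, t2Il, t2Il}, l1, false, t2Il, false⟩, ⟨{l1, l3, l3, l3}, l1, true, l3, false⟩,
      ⟨{l2, l2, l2, t2Il}, l2, true, l2, false⟩, ⟨{l2, l2, l2, l3}, l2, true, l2, false⟩,
      ⟨{l2, l2, l2, t2I2l}, t2I2l, false, l2, false⟩, ⟨{l2, l2, t2Il, t2Il}, l2, false, t2Il, false⟩,
      ⟨{l2, l2, l3, l3}, l2, true, l2, false⟩, ⟨{l2, t2Il, t2Il, t2Il}, l2, false, t2Il, false⟩,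
      ⟨{l2, l3, l3, l3}, l2, true, l3, false⟩, ⟨{t2Il, t2Il, t2Il, t2Il}, t2Il, true, t2Il, false⟩,
      ⟨{l3, l3, l3, l3}, l3, true, l3, false⟩],
     []),
    -- round 5: 0 N-shapes and 6 P-shapes leave
    ([],
     [⟨{lO, l1, l1, t2Il}, l1, false, t2Il, true⟩, ⟨{l1, l1, l1, l2}, l1, false, l2, true⟩,
      ⟨{l1, l1, l1, t2Il}, l1, true, t2Il, true⟩, ⟨{l1, l1, l2, l2}, l1, false, l2, true⟩,
      ⟨{l1, l2, l2, l2}, l1, false, l2, true⟩, ⟨{l2, l2, l2, l2}, l2, true, l2, false⟩]),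
    -- round 6: 1 N-shapes and 0 P-shapes leave
    ([⟨{l1, l1, l1, t2Il}, l1, true, l1, false⟩],
     []) ]

/-- **M*(U6), `N`-side** (37 shapes = bc5-plan's 52 `N`-orbits: the 5 fully charged shapes `[ℓ^a 2ℓ^b]` are 4 phase classes each). -/
def u6MstarN : List (Multiset (ℕ × ℕ)) :=
  [ {lO, lO, lO, lO}, {lO, lO, lO, l1}, {lO, lO, lO, l2}, {lO, lO, lO, t2Il}, {lO, lO, lO, l3}, {lO, lO, lO, t2I2l},
    {lO, lO, l1, l1}, {lO, lO, l1, l2}, {lO, lO, l1, t2Il}, {lO, lO, l1, l3}, {lO, lO, l1, t2I2l}, {lO, lO, l2, l2},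
    {lO, lO, l2, t2Il}, {lO, lO, l2, l3}, {lO, lO, l2, t2I2l}, {lO, lO, t2Il, t2Il}, {lO, lO, t2Il, l3}, {lO, lO, l3, l3},
    {lO, lO, l3, t2I2l}, {lO, l1, l1, l1}, {lO, l1, l1, l2}, {lO, l1, l1, t2Il}, {lO, l1, l1, l3}, {lO, l1, l2, l2},
    {lO, l1, l2, t2Il}, {lO, l1, l2, l3}, {lO, l1, l3, l3}, {lO, l2, l2, l2}, {lO, l2, l2, t2Il}, {lO, l2, l2, l3},
    {lO, l2, l3, l3}, {lO, l3, l3, l3}, {l1, l1, l1, l1}, {l1, l1, l1, l2}, {l1, l1, l2, l2}, {l1, l2, l2, l2},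
    {l2, l2, l2, l2} ]

/-- **M*(U6), `P`-side** (19 shapes = 22 `P`-orbits). -/
def u6MstarP : List (Multiset (ℕ × ℕ)) :=
  [ {lO, lO, lO, lO}, {lO, lO, lO, l1}, {lO, lO, lO, l2}, {lO, lO, lO, t2Il}, {lO, lO, lO, l3}, {lO, lO, lO, t2I2l},
    {lO, lO, l1, l1}, {lO, lO, l1, l2}, {lO, lO, l1, t2Il}, {lO, lO, l1, l3}, {lO, lO, l2, l2}, {lO, lO, l2, t2Il},
    {lO, lO, l2, l3}, {lO, lO, l3, l3}, {lO, l1, l1, l1}, {lO, l1, l1, l2}, {lO, l1, l2, l2}, {lO, l2, l2, l2},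
    {l1, l1, l1, l1} ]

/-- the stage-1 certificate checks out (decoding, rounds on codes, survivors = `u6MstarN` ∕ `u6MstarP`). [kernel, `decide`] -/
theorem u6Rounds_ok :
    CertsInj u6Keys u6Rounds ∧ roundsOK 3 (u6Keys.map kenc) (u6Keys.map kenc) u6Rounds = true ∧
      (∀ K ∈ u6Keys, kenc K ∈ finalN (u6Keys.map kenc) (u6Keys.map kenc) u6Rounds ↔ K ∈ u6MstarN) ∧
      (∀ K ∈ u6Keys, kenc K ∈ finalP (u6Keys.map kenc) (u6Keys.map kenc) u6Rounds ↔ K ∈ u6MstarP) := by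
  decide +kernel

/-- **every RULE-D-closed support inside U6^ℝ lies in M*(U6)** (bc5-plan g3 l.30322 ∕ memo §13 (G); ×2 s4-ref g72 (D)). -/
theorem u6_support_subset_Mstar (C : Config) (hC : RuleDClosed C) (hN : ∀ Z ∈ C.lower, InU6 Z)
    (hP : ∀ P ∈ C.upper, InU6 P) :
    (∀ Z ∈ C.lower, Z.key ∈ u6MstarN) ∧ (∀ P ∈ C.upper, P.key ∈ u6MstarP) := by
  obtain ⟨hinj, hok, hdecN, hdecP⟩ := u6Rounds_ok
  have hUN : ∀ Z ∈ C.lower, Z.key ∈ u6Keys := fun Z hZ => key_mem_u6Keys (hN Z hZ)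
  have hUP : ∀ P ∈ C.upper, P.key ∈ u6Keys := fun P hPu => key_mem_u6Keys (hP P hPu)
  obtain ⟨hfN, hfP⟩ := rounds_sound hC hUN hUP (fun N hNl => coordBounded_of_letters u6Keys_spec.2 (hN N hNl)) u6Rounds
    _ _ hinj hok (fun Z hZ => List.mem_map_of_mem (hUN Z hZ)) (fun P hPu => List.mem_map_of_mem (hUP P hPu))
  exact ⟨fun Z hZ => (hdecN _ (hUN Z hZ)).1 (hfN Z hZ), fun P hPu => (hdecP _ (hUP P hPu)).1 (hfP P hPu)⟩

/-! ## §3 Stage (i): the three tower species of M*(U6) are A2I-dead in G-invariant RULE-D-closed supports -/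

/-- the species sit in M*(U6), and every `P`-shape of M*(U6) carrying the tower `2I+ℓ` has two O-factors ((C1)∕(F-c) for U6:
the extra `P`-orbits pollute nothing). [kernel, `decide`] -/
theorem u6Mstar_species_facts :
    (∀ K ∈ speciesKeys, K ∈ u6MstarN) ∧ (∀ K ∈ u6MstarP, (2, 1) ∈ K → 2 ≤ K.count (0, 0)) := by decide +kernel

/-- **STEP (i) of the U6 decision tree, (F1ℝ) slice** (bc5-plan g3 l.30322, kit j274473; ×2 s4-ref g72 ba57d2acffb5afa2 (C):
«[O|ℓ|ℓ|T] 1536∕1536 · [O|ℓ|2ℓ|T] 3072∕3072 · [O|2ℓ|2ℓ|T] 1536∕1536 KILLED, Dir = {u}, W = ∅, own-orbit servers, census EMPTY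
against all P-classes of M*(U6)»): in a RULE-D-closed configuration inside U6^ℝ with G-invariant `N`-support, every species cell
satisfies `A2IDead` (same mechanism as `Pad4TowerUniverseDT1.species_A2IDead`, with the `P`-shapes of M*(U6)). -/
theorem u6_species_A2IDead (C : Config) (hC : RuleDClosed C) (hN : ∀ Z ∈ C.lower, InU6 Z) (hP : ∀ P ∈ C.upper, InU6 P)
    (hG : GInvariant C.lower) {Z : Cell} (hZ : Z ∈ C.lower) (hk : Z.key ∈ speciesKeys) :
    ∃ σ f'' : Fin 4, A2IDead C Z σ f'' :=
  species_A2IDead C u6Mstar_species_facts.2 (u6_support_subset_Mstar C hC hN hP).2 hG hZ hk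

/-! ## §4 Stage (i′): species-free RULE-D-closed supports lie in M**(U6) (2 rounds: P [O|O|ℓ|T], [O|O|2ℓ|T]; then N [O|O|T|T]) -/

/-- the second-stage rounds, starting from (M*(U6) `N`-shapes minus the species, M*(U6) `P`-shapes). -/
def u6Rounds2 : List Round :=
  [ -- round 1: 0 N-shapes and 2 P-shapes leave
    ([],
     [⟨{lO, lO, l1, t2Il}, t2Il, false, lO, true⟩, ⟨{lO, lO, l2, t2Il}, t2Il, false, lO, true⟩]),
    -- round 2: 1 N-shapes and 0 P-shapes leave
    ([⟨{lO, lO, t2Il, t2Il}, t2Il, false, lO, true⟩],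
     []) ]

/-- **M**(U6), `N`-side** (33 shapes = 48 orbits). -/
def u6MssN : List (Multiset (ℕ × ℕ)) :=
  [ {lO, lO, lO, lO}, {lO, lO, lO, l1}, {lO, lO, lO, l2}, {lO, lO, lO, t2Il}, {lO, lO, lO, l3}, {lO, lO, lO, t2I2l},
    {lO, lO, l1, l1}, {lO, lO, l1, l2}, {lO, lO, l1, t2Il}, {lO, lO, l1, l3}, {lO, lO, l1, t2I2l}, {lO, lO, l2, l2},
    {lO, lO, l2, t2Il}, {lO, lO, l2, l3}, {lO, lO, l2, t2I2l}, {lO, lO, t2Il, l3}, {lO, lO, l3, l3}, {lO, lO, l3, t2I2l},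
    {lO, l1, l1, l1}, {lO, l1, l1, l2}, {lO, l1, l1, l3}, {lO, l1, l2, l2}, {lO, l1, l2, l3}, {lO, l1, l3, l3},
    {lO, l2, l2, l2}, {lO, l2, l2, l3}, {lO, l2, l3, l3}, {lO, l3, l3, l3}, {l1, l1, l1, l1}, {l1, l1, l1, l2},
    {l1, l1, l2, l2}, {l1, l2, l2, l2}, {l2, l2, l2, l2} ]

/-- **M**(U6), `P`-side** (17 shapes = 20 orbits; total 68 orbits = s4-ref g72 (D)). -/
def u6MssP : List (Multiset (ℕ × ℕ)) :=
  [ {lO, lO, lO, lO}, {lO, lO, lO, l1}, {lO, lO, lO, l2}, {lO, lO, lO, t2Il}, {lO, lO, lO, l3}, {lO, lO, lO, t2I2l},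
    {lO, lO, l1, l1}, {lO, lO, l1, l2}, {lO, lO, l1, l3}, {lO, lO, l2, l2}, {lO, lO, l2, l3}, {lO, lO, l3, l3},
    {lO, l1, l1, l1}, {lO, l1, l1, l2}, {lO, l1, l2, l2}, {lO, l2, l2, l2}, {l1, l1, l1, l1} ]

/-- the stage-2 certificate checks out (from the codes of M*(U6)'s species-free `N`-shapes and of M*(U6)'s `P`-shapes).
[kernel, `decide`] -/
theorem u6Rounds2_ok :
    CertsInj u6Keys u6Rounds2 ∧
    roundsOK 3 ((u6MstarN.filter fun K => K ∉ speciesKeys).map kenc) (u6MstarP.map kenc) u6Rounds2 = true ∧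
      (∀ K ∈ u6Keys, kenc K ∈ finalN ((u6MstarN.filter fun K => K ∉ speciesKeys).map kenc) (u6MstarP.map kenc) u6Rounds2 ↔
        K ∈ u6MssN) ∧
      (∀ K ∈ u6Keys, kenc K ∈ finalP ((u6MstarN.filter fun K => K ∉ speciesKeys).map kenc) (u6MstarP.map kenc) u6Rounds2 ↔
        K ∈ u6MssP) := by
  decide +kernel

/-- **STEP (i′)**: a RULE-D-closed configuration inside U6^ℝ WITHOUT species cells has all its shapes in M**(U6). (The pencil step
«dead ⇒ absent from an (E1)-alive design» that licenses dropping the species is LEMMA A∪2I′'s meaning — NOT a Lean statement; here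
species-freeness is a HYPOTHESIS.) -/
theorem u6_speciesFree_subset_Mss (C : Config) (hC : RuleDClosed C) (hN : ∀ Z ∈ C.lower, InU6 Z)
    (hP : ∀ P ∈ C.upper, InU6 P) (hfree : ∀ Z ∈ C.lower, Z.key ∉ speciesKeys) :
    (∀ Z ∈ C.lower, Z.key ∈ u6MssN) ∧ (∀ P ∈ C.upper, P.key ∈ u6MssP) := by
  obtain ⟨hMN, hMP⟩ := u6_support_subset_Mstar C hC hN hP
  obtain ⟨hinj, hok, hdecN, hdecP⟩ := u6Rounds2_ok
  have hUN : ∀ Z ∈ C.lower, Z.key ∈ u6Keys := fun Z hZ => key_mem_u6Keys (hN Z hZ)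
  have hUP : ∀ P ∈ C.upper, P.key ∈ u6Keys := fun P hPu => key_mem_u6Keys (hP P hPu)
  obtain ⟨hfN, hfP⟩ := rounds_sound hC hUN hUP (fun N hNl => coordBounded_of_letters u6Keys_spec.2 (hN N hNl)) u6Rounds2
    _ _ hinj hok (fun Z hZ => List.mem_map_of_mem (List.mem_filter.2 ⟨hMN Z hZ, decide_eq_true (hfree Z hZ)⟩))
    (fun P hPu => List.mem_map_of_mem (hMP P hPu))
  exact ⟨fun Z hZ => (hdecN _ (hUN Z hZ)).1 (hfN Z hZ), fun P hPu => (hdecP _ (hUP P hPu)).1 (hfP P hPu)⟩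

/-! ## §5 The alive part of U6: on M**(U6) the no-O shapes are class-y ray shapes, fully charged on both levels -/

/-- **the Ψ ∕ O ∕ letter table of M**(U6)** (s4-ref g72 (E): «Ψ ≠ 0 on M** = the 20 class-y FC N's (Ψ = Πc) + P [ℓ⁴]_k (Ψ = 1),
every non-FC orbit incl. the two-O towers Ψ = 0»): on both levels a surviving shape with an O-factor has Ψ = 0; a surviving shape
WITHOUT O-factor has Ψ > 0 and consists of pure rays `(c, 0)` only — a class-y shape `[ℓ^a 2ℓ^b]` (N) resp. `[ℓℓℓℓ]` (P); every
tower of M** sits next to at least two O's. [kernel, `decide`] -/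
theorem u6Mss_table :
    (∀ K ∈ u6MssN ++ u6MssP, ((0, 0) ∈ K → psiKey K = 0) ∧ ((0, 0) ∉ K → 0 < psiKey K ∧ ∀ z ∈ K, z.2 = 0)) ∧
    (∀ K ∈ u6MssP, (0, 0) ∉ K → K = {(1, 0), (1, 0), (1, 0), (1, 0)}) ∧
    (∀ K ∈ u6MssN ++ u6MssP, ∀ z ∈ K, z.2 ≠ 0 → 2 ≤ K.count (0, 0)) := by
  decide +kernel

/-- **THE U6 REDUCTION — (F1ℝ) SLICE, KERNEL FORM** (bc5-plan g3 l.30322 «HENCE (×1)», ×2 s4-ref g72 ba57d2acffb5afa2: «every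
(H1)-alive RULE-D-closed two-level support over {O,ℓ,2ℓ,3ℓ,2I+ℓ,2I+2ℓ} is a CLASS-y DESIGN ON BOTH LEVELS (P-side FC = [ℓℓℓℓ]
only) decorated with Ψ-null, non-FC material» — U6 is NOT closed by this; the decorated class-y cores are THEOREM L^ζ's
business, kernel-open `Pad4FirstOrderModel.TheoremLZeta`). For a two-level (F1ℝ) design with letters in the U6 alphabet, RULE-D-closed
support, NO species constituent (the pencil consequence of §3 — hypothesis here), the Ψ-row and `μ ≠ 0` ((H1)): every constituent
without O-factor is a class-y ray cell (all four letters pure rays), and such constituents occur on BOTH levels, the `P`-side ones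
being `[ℓℓℓℓ]`. Nothing here says HC ∕ HC_CM ∕ HC_AV holds or fails. -/
theorem u6_alive_part_classY (lower upper : List Cell) (hN : ∀ Z ∈ lower, InU6 Z) (hP : ∀ P ∈ upper, InU6 P)
    (hD : RuleDClosed ⟨lower.toFinset, upper.toFinset⟩) (hfree : ∀ Z ∈ lower, Z.key ∉ speciesKeys)
    (hΨ : psiSumC lower = psiSumC upper) (h1 : muC lower upper ≠ 0) :
    (∀ X ∈ lower ++ upper, (0, 0) ∉ X.key → ∀ f, (nl X f).2 = 0) ∧
      (∃ N ∈ lower, (0, 0) ∉ N.key) ∧ (∃ P ∈ upper, P.key = {(1, 0), (1, 0), (1, 0), (1, 0)}) := by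
  obtain ⟨htab, hP4, -⟩ := u6Mss_table
  obtain ⟨hinN, hinP⟩ := u6_speciesFree_subset_Mss _ hD (fun Z hZ => hN Z (List.mem_toFinset.1 hZ))
    (fun P hPu => hP P (List.mem_toFinset.1 hPu)) fun Z hZ => hfree Z (List.mem_toFinset.1 hZ)
  have hin : ∀ X ∈ lower ++ upper, X.key ∈ u6MssN ++ u6MssP := fun X hX => by
    rcases List.mem_append.1 hX with h | h
    · exact List.mem_append_left _ (hinN X (List.mem_toFinset.2 h))
    · exact List.mem_append_right _ (hinP X (List.mem_toFinset.2 h))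
  refine ⟨fun X hX hO f => ((htab _ (hin X hX)).2 hO).2 _ (nl_mem_key X f), ?_⟩
  -- Ψ ≥ 0 termwise on both levels; Ψ > 0 exactly at the no-O constituents
  have hnn : ∀ l : List Cell, (∀ X ∈ l, X.key ∈ u6MssN ++ u6MssP) → ∀ x ∈ l.map Cell.psi, (0 : ℚ) ≤ x :=
    fun l hl x hx => by
      obtain ⟨X, hX, rfl⟩ := List.mem_map.1 hx
      rw [psi_eq_psiKey]
      by_cases hO : (0, 0) ∈ X.key
      · exact ((htab _ (hl X hX)).1 hO).ge
      · exact ((htab _ (hl X hX)).2 hO).1.le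
  have hlowin : ∀ X ∈ lower, X.key ∈ u6MssN ++ u6MssP := fun X hX => hin X (List.mem_append_left _ hX)
  have hupin : ∀ X ∈ upper, X.key ∈ u6MssN ++ u6MssP := fun X hX => hin X (List.mem_append_right _ hX)
  -- a level all of whose constituents have an O-factor has Ψ-mass 0; a level with a no-O constituent has Ψ-mass > 0
  have hzero : ∀ l : List Cell, (∀ X ∈ l, X.key ∈ u6MssN ++ u6MssP) → (∀ X ∈ l, (0, 0) ∈ X.key) → psiSumC l = 0 :=
    fun l hl hO => List.sum_eq_zero fun x hx => by
      obtain ⟨X, hX, rfl⟩ := List.mem_map.1 hx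
      rw [psi_eq_psiKey]; exact (htab _ (hl X hX)).1 (hO X hX)
  have hpos : ∀ l : List Cell, (∀ X ∈ l, X.key ∈ u6MssN ++ u6MssP) → ∀ X ∈ l, (0, 0) ∉ X.key → 0 < psiSumC l :=
    fun l hl X hX hO => lt_of_lt_of_le (by rw [psi_eq_psiKey]; exact ((htab _ (hl X hX)).2 hO).1)
      (List.single_le_sum (hnn l hl) _ (List.mem_map.2 ⟨X, hX, rfl⟩))
  -- (H1) gives a no-O constituent somewhere; the Ψ-row then forces one on each level
  obtain ⟨X, hXmem, hX⟩ := exists_muTermC_ne_zero h1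
  have hXO := zero_notMem_key_of_muTermC hX
  have hlowO : ∃ N ∈ lower, (0, 0) ∉ N.key := by
    by_contra hno
    push Not at hno
    rcases List.mem_append.1 hXmem with h | h
    · exact hXO (hno X h)
    · have := hpos upper hupin X h hXO
      rw [← hΨ, hzero lower hlowin hno] at this
      exact lt_irrefl _ this
  have hupO : ∃ P ∈ upper, (0, 0) ∉ P.key := by
    by_contra hno
    push Not at hno
    obtain ⟨N, hNl, hNO⟩ := hlowO
    have := hpos lower hlowin N hNl hNO
    rw [hΨ, hzero upper hupin hno] at this
    exact lt_irrefl _ this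
  obtain ⟨P, hPu, hPO⟩ := hupO
  exact ⟨hlowO, P, hPu, hP4 _ (hinP P (List.mem_toFinset.2 hPu)) hPO⟩

end Summit.Ventures.HSemireg.Pad4Tower
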